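import Literature.NumberTheory.Automorphic.CDTTheorem722
import Literature.NumberTheory.Automorphic.FLSModularityLiftingTheorem
import Literature.NumberTheory.Automorphic.CDTTheorem722SerreProofs
import Literature.NumberTheory.EllipticCurves.IsogenyFrobeniusTraceHoldsProofs
import Literature.NumberTheory.EllipticCurves.MatarNekovar2019.IrreducibleOverQuadraticFieldClauseThreeProofs
import HarnessLib

/-!
# Stub-ideation k1, GEN 3 (2026-08-31) for `stub_liftThree` (crux stmt-ABC-11340 `FreyModularity`, line `Sketch`)

Backs `STUB-IDEAS-stub_liftThree-1.md` (HOME FAMILY 1 — RECOGNISE & IMPORT).  Elaboration sanity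
only: every `sorry` is a HELPER LEMMA offered to the stub prover (one prover cycle each), every
sorry-free theorem is a closer / assembly the prover can copy.  Gen 1 (`STUB_IDEAS_stub_liftThree_1.lean`:
Rubin Thm B seat, FLS-Thm-2 glue (b)–(e)) and gen 2 (`STUB_IDEAS_stub_liftThree_1g2.lean`: Diamond
CSS-XVII Cor 6.3 seat + ℓ = 3 weight bridge, all closers proved) stay valid and are NOT repeated.

What gen 3 adds (Family 1, technique "tree match" + "analogy transfer from the solved sibling cut"):
the EXISTING accepted named fact `FLS2015_theorem3` (Freitas–Le Hung–Siksek 2015 Thm 3, `p = 3 ∨ 5`,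
Langlands–Tunnell INSIDE, no residual-modularity hypothesis, no condition at `p`) closes the stub at
`(K, p) = (ℚ, 3)` modulo THREE ℚ-bridges that are VERBATIM those of the sibling plan
`STUB_IDEAS_stub_liftFive_1.lean` (gen 3, B3/B4/B6 — one copy serves both lifting stubs) and ONE
`p = 3`-specific packaging lemma D1, which is easier than the sibling's B1 because `ℚ(ζ₃) = ℚ(√-3)`
(no Clifford / index-two argument): D1 is PROVED below from two S-sized helpers D1a (field theory)
and D1b (conjugation invariance).  Compared with gen 1's FLS road (Thm 2: two L-glues (c), (e)), the
Thm-3 road has ONE L-glue (B3 = (e) re-targeted at `BCDT.IsModular`), shared with `stub_liftFive`.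
-/

set_option autoImplicit false
set_option linter.dupNamespace false

noncomputable section

open scoped MatrixGroups NumberField Polynomial
open Polynomial NumberField
open Literature.NumberTheory.EllipticCurves
open Literature.NumberTheory.EllipticCurves.ModularForms
open Literature.NumberTheory.Automorphic
open Literature.NumberTheory.Automorphic.BCDT
open Literature.NumberTheory.GaloisRepresentations

namespace Summit.ABC.ABC.Cruxes.FreyModularity.Sketch.StubIdeas1g3

/-- The registered signature of `stub_liftThree` (verbatim copy; the stub itself is not re-typed). -/
def SigStubLiftThree : Prop :=
  ∀ (W : WeierstrassCurve ℚ) [W.IsElliptic] (ρ : ModPGaloisRep ℚ (ZMod 3) 2),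
    W.IsTorsionGaloisRep 3 ρ → ρ.IsAbsIrreducibleOverSqrt (-3) → ¬ 9 ∣ W.conductorNorm ℤ →
    ρ.IsModular → W.IsModularGaloisRepTate 3

/-! ## D1 — the `p = 3` packaging: CDT's "`ρ̄|_{ℚ(√-3)}` abs. irreducible" (ONE framing) is FLS's
"`ρ̄_{E,3}(G_{ℚ(ζ₃)})` abs. irreducible" (ALL framings, all models of `ℚ(ζ₃)`) -/

/-- **D1a (S, field theory).** Every model `L` of `ℚ(ζ₃)` is a splitting field of `X² + 3` over `ℚ`:
`(2ζ₃ + 1)² = 4(ζ₃² + ζ₃ + 1) - 3 = -3` (`Polynomial.cyclotomic_three`, `IsPrimitiveRoot.isRoot_cyclotomic`),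
so `X² + 3` splits in `L` with roots `±(2ζ₃+1)`, and `ζ₃ = ((2ζ₃+1) - 1)/2` lies in the subfield they
generate, which is all of `L` (`IsCyclotomicExtension.adjoin_roots`).  = gen 1 glue (d1). [folklore] -/
theorem isSplittingField_X_sq_add_three (L : Type) [Field L] [Algebra ℚ L]
    [IsCyclotomicExtension {3} ℚ L] : IsSplittingField ℚ L (X ^ 2 - C (-3 : ℚ)) := by
  sorry

/-- **D1b (S, conjugation invariance; = k2's H3d core, prove ONCE).** Absolute irreducibility of
the restriction `ρ̄|_{Γ_L}` is invariant under a change of frame `ρ̄ ↦ P ρ̄ P⁻¹`: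
`restrictField L (conj P ρ̄) = conj P (restrictField L ρ̄)` (`FramedRep.conj_comp`; `restrictField`
is `comp (absGaloisRestrict ℚ L)`), and for every `f : 𝔽₃ →+* B` the base-changed representation
of `conj P σ` is isomorphic to that of `σ` via the linear automorphism `P.map f` of `B²`
(Mathlib: irreducibility = simplicity of the module, transported along a `LinearEquiv` of
representations). [folklore] -/
theorem isAbsolutelyIrreducible_restrictField_conj (L : Type) [Field L] [Algebra ℚ L]
    (P : GL (Fin 2) (ZMod 3)) (ρ : ModPGaloisRep ℚ (ZMod 3) 2)
    (h : FramedRep.IsAbsolutelyIrreducible (FramedGaloisRep.restrictField L ρ)) :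
    FramedRep.IsAbsolutelyIrreducible (FramedGaloisRep.restrictField L (FramedRep.conj P ρ)) := by
  sorry

/-- **D1 (PROVED from D1a + D1b).** For an elliptic `W / ℚ` and ONE framed model `ρ̄` of `W[3]`
with `ρ̄|_{ℚ(√-3)}` absolutely irreducible (`IsAbsIrreducibleOverSqrt (-3)`, the stub's binder),
FLS's hypothesis `ModPImageAbsIrreducibleOverCyclotomic W 3` holds: any other framing is `P ρ̄ P⁻¹`
(`IsTorsionGaloisRep.exists_conj_eq`), and any model of `ℚ(ζ₃)` is a model of `ℚ(√-3)` (D1a).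
At `p = 5` the analogous step (sibling B1) needs an index-two Clifford argument; at `p = 3` it does not. -/
theorem modPImageAbsIrreducibleOverCyclotomic_three_of_isAbsIrreducibleOverSqrt
    (W : WeierstrassCurve ℚ) [W.IsElliptic] (ρ : ModPGaloisRep ℚ (ZMod 3) 2)
    (hρ : W.IsTorsionGaloisRep 3 ρ) (hirr : ρ.IsAbsIrreducibleOverSqrt (-3)) :
    ModPImageAbsIrreducibleOverCyclotomic W 3 := by
  intro ρ' hρ' L _ _ _
  obtain ⟨P, rfl⟩ := hρ.exists_conj_eq hρ'
  haveI : IsSplittingField ℚ L (X ^ 2 - C (-3 : ℚ)) := isSplittingField_X_sq_add_three L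
  exact isAbsolutelyIrreducible_restrictField_conj L P ρ (hirr L)

/-! ## The three ℚ-bridges — VERBATIM the sibling's B4, B6, B3 (`STUB_IDEAS_stub_liftFive_1.lean`,
gen 3); one landed copy serves `stub_liftThree` AND `stub_liftFive` -/

/-- **B4 (S, integral model).** Every elliptic `W/ℚ` is `ℚ`-isomorphic (clear denominators,
`u = 1/d`) to the base change of an integral model `E/𝓞 ℚ` with `Δ(E) ≠ 0`. [folklore] -/
theorem exists_integralModel (W : WeierstrassCurve ℚ) [W.IsElliptic] :
    ∃ (E : WeierstrassCurve (𝓞 ℚ)) (C : WeierstrassCurve.VariableChange ℚ)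
      (_ : (E.baseChange ℚ).IsElliptic), E.Δ ≠ 0 ∧ C • W = E.baseChange ℚ := by
  sorry

/-- **B6 (S, isomorphism invariance of BCDT-modularity).** `IsModular (C • W) → IsModular W`:
`N_{C•W} = N_W` (`WeierstrassCurve.conductorNorm_smul_rat`) and `IsNewformOf (C • W) g ↔ IsNewformOf W g`
(`EllipticCurves.isNewformOf_smul_iff`); only the transport of `g` along the equality of levels is
to be written. [folklore] -/
theorem isModular_of_smul_eq (W : WeierstrassCurve ℚ) [W.IsElliptic] [NeZero (W.conductorNorm ℤ)]
    (C : WeierstrassCurve.VariableChange ℚ) (W' : WeierstrassCurve ℚ) [NeZero (W'.conductorNorm ℤ)]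
    (hCW : C • W = W') : BCDT.IsModular W' → BCDT.IsModular W := by
  sorry

/-- **B3 (L — the ONE large debt of the FLS road, candidate NAMED FACT; verbatim the sibling's).**
"Carayol's way back", adelic ⇒ classical over `ℚ`: a weight-zero cuspidal `π` of `GL₂(𝔸_ℚ)` with
Hecke polynomial `X² − a_p(E) X + p` at every `p ∤ Δ(E)` (`IsAutomorphicOfWeightZero E`) yields the
newform `f ∈ S₂(Γ₀(N_E))` with `aₙ(f) = aₙ(E)` (`BCDT.IsModular`): new vector of `π`
(Casselman 1973; Gelbart 1975 Thm 5.19 / Prop 6.21 — held text p0062/p0080), `ρ_f`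
(`eichlerShimuraConstruction`, already the leaf of S9 `stub_threeImpTwo`), `ρ_f ≅ V_ℓ E`
(Chebotarev + Brauer–Nesbitt + Faltings `isIsogenous_iff_frobeniusTrace_eq_holds`), all Euler
factors and `N_f = N_E` (Carayol 1986).  Prime-independent: the same Prop closes `stub_liftFive`. -/
def IsModularOfAutomorphicRat : Prop :=
  ∀ (E : WeierstrassCurve (𝓞 ℚ)) [(E.baseChange ℚ).IsElliptic]
    [NeZero ((E.baseChange ℚ).conductorNorm ℤ)],
    E.Δ ≠ 0 → IsAutomorphicOfWeightZero E → BCDT.IsModular (E.baseChange ℚ)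

/-! ## Closers (kernel-checked modulo the sorried helpers above) -/

/-- **Closer D (GEN 3): the EXISTING named fact `FLS2015_theorem3` at `(K, p) = (ℚ, 3)` closes the
stub**, granted B3; the stub's binders `¬ 9 ∣ N_W` and `ρ.IsModular` are NOT used (Disproof.lean
§B6: no binder of `stub_liftThree` is load-bearing for truth).  Torsion transport along
`C • W = E ⊗ ℚ` is the tree's `MatarNekovar2019.isTorsionGaloisRep_smul`; the end is the PROVED
(2) ⇒ (4) `BCDT.IsModular.isModularGaloisRepTate`. -/
theorem stub_liftThree_of_FLS2015_theorem3 (h : FLS2015_theorem3) (hB3 : IsModularOfAutomorphicRat) :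
    SigStubLiftThree := by
  intro W _ ρ hρ hirr _ _
  haveI : NeZero (W.conductorNorm ℤ) := ⟨(WeierstrassCurve.conductorNorm_pos_holds W).ne'⟩
  obtain ⟨E, C, _, hΔ, hCW⟩ := exists_integralModel W
  haveI : NeZero ((E.baseChange ℚ).conductorNorm ℤ) :=
    ⟨(WeierstrassCurve.conductorNorm_pos_holds (E.baseChange ℚ)).ne'⟩
  have himgW : ModPImageAbsIrreducibleOverCyclotomic W 3 :=
    modPImageAbsIrreducibleOverCyclotomic_three_of_isAbsIrreducibleOverSqrt W ρ hρ hirr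
  have himgE : ModPImageAbsIrreducibleOverCyclotomic (E.baseChange ℚ) 3 := by
    intro ρ' hρ' L _ _ _
    have hW : W.IsTorsionGaloisRep 3 ρ' := by
      have h' := MatarNekovar2019.isTorsionGaloisRep_smul (E.baseChange ℚ) C⁻¹ hρ'
      rwa [← hCW, inv_smul_smul] at h'
    exact himgW ρ' hW L
  have hE : IsAutomorphicOfWeightZero E := h ℚ E hΔ 3 (Or.inl rfl) himgE
  exact (isModular_of_smul_eq W C (E.baseChange ℚ) hCW (hB3 E hΔ hE)).isModularGaloisRepTate 3

/-- The same from the JOINT carrier `FLS2015_theorems3_4` (the seat the Langlands-summit route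
`SqrtFiveQuarticCovers` consumes; `FLS2015_theorem3_of_theorems3_4` is in the tree): progress on
that seat propagates to BOTH lifting stubs of this crux. -/
theorem stub_liftThree_of_FLS2015_theorems3_4 (h : FLS2015_theorems3_4)
    (hB3 : IsModularOfAutomorphicRat) : SigStubLiftThree :=
  stub_liftThree_of_FLS2015_theorem3 (FLS2015_theorem3_of_theorems3_4 h) hB3

/-! ## B3 one level down (the sibling k2's split, `STUB_IDEAS_stub_liftFive_2.lean` D4a/D4, ported):
B3 = D4a (the ONE non-tree input, prime-independent) + Eichler–Shimura + Carayol, the two leaves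
ALREADY in the line's trust base through S9 `stub_threeImpTwo` -/

/-- **D4a (L, prime-independent; VERBATIM the sibling k2's `exists_isNewform0_of_isAutomorphicOfWeightZero_rat`
— one landed copy serves both lifting stubs).**  A weight-zero cuspidal `π` of `GL₂(𝔸_ℚ)` with Hecke
polynomials `X² − a_q(E) X + q` at all `q ∤ Δ(E)` comes from a newform `g ∈ S₂(Γ₀(M))` with
`a_q(g) = a_q(E ⊗ ℚ)` off `M·R`: central character trivial + `π_∞ = D₂` (weight zero), new vector
(tree, PROVED: `CuspidalAutomorphicRepData.exists_gammaOneFiniteLevel_fixed`, Casselman 1973),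
Atkin–Lehner to a newform (`exists_isNewform1_of_mem_newSubspace1`), `a_q(g) = a_q(E)` by strong
multiplicity one at unramified `q` — the weight-2 port of the tree's weight-1 descent
`IsOfWeightOne.exists_isNewform1_of_exists_fixed`. [cite: Gelbart1975, Thm. 5.19 and Prop. 6.21] -/
theorem exists_isNewform0_of_isAutomorphicOfWeightZero_rat (E : WeierstrassCurve (𝓞 ℚ))
    (hΔ : E.Δ ≠ 0) (hE : IsAutomorphicOfWeightZero E) :
    ∃ (M : ℕ) (_ : NeZero M) (g : CuspForm (CongruenceSubgroup.Gamma0 M) 2), IsNewform0 g ∧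
      ∃ (R : ℕ) (_ : NeZero R), ∀ q : ℕ, q.Prime → ¬ q ∣ M * R →
        cuspCoeff g q = ((E.baseChange ℚ).LFunction q : ℂ) := by
  sorry

/-- **B3 PROVED from D4a granted Eichler–Shimura (`hES`) and Carayol (`hC`)** — Serre 1987 §4.6
last paragraph as the tree's `isModular_of_isNewform0_of_cuspCoeff_eq_off_of_three_facts`, Faltings
discharged by `isIsogenous_iff_frobeniusTrace_eq_holds`. [folklore] -/
theorem isModularOfAutomorphicRat_of_two_facts (hES : eichlerShimuraConstruction)
    (hC : ∀ (N : ℕ) [NeZero N], IsNewformOf.level_eq_conductorNorm (N := N)) :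
    IsModularOfAutomorphicRat := by
  intro E _ _ hΔ hE
  obtain ⟨M, _, g, hg, R, _, h⟩ := exists_isNewform0_of_isAutomorphicOfWeightZero_rat E hΔ hE
  exact isModular_of_isNewform0_of_cuspCoeff_eq_off_of_three_facts hES
    WeierstrassCurve.isIsogenous_iff_frobeniusTrace_eq_holds hC (E.baseChange ℚ) hg h

/-- **Closer D″ (GEN 3, kernel-checked modulo D1a, D1b, B4, B6, D4a): trust base = the skeleton's
own leaves {Eichler–Shimura, Carayol} (S9) ∪ {`FLS2015_theorem3`}; no new named fact at all.** -/
theorem stub_liftThree_of_FLS2015_theorem3_of_two_facts (h : FLS2015_theorem3)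
    (hES : eichlerShimuraConstruction)
    (hC : ∀ (N : ℕ) [NeZero N], IsNewformOf.level_eq_conductorNorm (N := N)) : SigStubLiftThree :=
  stub_liftThree_of_FLS2015_theorem3 h (isModularOfAutomorphicRat_of_two_facts hES hC)

/-- **Gen 1's glue (c) as a named Prop (L; ℓ = 3-specific).** Classical ⇒ adelic residual
modularity over `ℚ` at `ℓ = 3`: BCDT's any-weight `ρ.IsModular` ⇒ FLS's `ρ.IsHilbertModular`
(a weight-ZERO = parallel-weight-2 cuspidal `π` of `GL₂(𝔸_ℚ)` matching `ρ̄` mod `λ` a.e.).  It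
CONTAINS the ℓ = 3 weight passage of gen 2 §1 (weight-one witness ↦ weight two: Diamond 1995
Thm 6.4 / Gelbart CSS §1.4 Steps 4–5), then `f ↦ π_f` (tree: `exists_hasWeightZero_satake_of_isNewformOf`
covers only the elliptic-curve case).  Only the Thm-2 road (closer below) needs it; the Thm-3 road does not. -/
def IsHilbertModularOfIsModularRatThree : Prop :=
  ∀ ρ : ModPGaloisRep ℚ (ZMod 3) 2, FramedRep.IsAbsolutelyIrreducible ρ → ρ.IsModular →
    ρ.IsHilbertModular

/-- **Closer D′: the accepted `FLS2015_theorem2` (Thm 2 = Breuil–Diamond 3.2.2 / Kisin / BLGG) at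
`(ℚ, 3)`** — uses the stub's `hmod` through `IsHilbertModularOfIsModularRatThree`, drops `¬ 9 ∣ N_W`.
Two L-debts (B3 and the bridge) instead of one: ranked below closer D. -/
theorem stub_liftThree_of_FLS2015_theorem2 (h : FLS2015_theorem2)
    (hc : IsHilbertModularOfIsModularRatThree) (hB3 : IsModularOfAutomorphicRat) :
    SigStubLiftThree := by
  intro W _ ρ hρ hirr _ hmod
  haveI : NeZero (W.conductorNorm ℤ) := ⟨(WeierstrassCurve.conductorNorm_pos_holds W).ne'⟩
  obtain ⟨E, C, _, hΔ, hCW⟩ := exists_integralModel W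
  haveI : NeZero ((E.baseChange ℚ).conductorNorm ℤ) :=
    ⟨(WeierstrassCurve.conductorNorm_pos_holds (E.baseChange ℚ)).ne'⟩
  have hρE : (E.baseChange ℚ).IsTorsionGaloisRep 3 ρ := by
    rw [← hCW]; exact MatarNekovar2019.isTorsionGaloisRep_smul W C hρ
  have himgW : ModPImageAbsIrreducibleOverCyclotomic W 3 :=
    modPImageAbsIrreducibleOverCyclotomic_three_of_isAbsIrreducibleOverSqrt W ρ hρ hirr
  have himgE : ModPImageAbsIrreducibleOverCyclotomic (E.baseChange ℚ) 3 := by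
    intro ρ' hρ' L _ _ _
    have hW : W.IsTorsionGaloisRep 3 ρ' := by
      have h' := MatarNekovar2019.isTorsionGaloisRep_smul (E.baseChange ℚ) C⁻¹ hρ'
      rwa [← hCW, inv_smul_smul] at h'
    exact himgW ρ' hW L
  have hE : IsAutomorphicOfWeightZero E :=
    h.of_exists ℚ E hΔ 3 (by norm_num) ⟨ρ, hρE, hc ρ hirr.isAbsolutelyIrreducible hmod⟩ himgE
  exact (isModular_of_smul_eq W C (E.baseChange ℚ) hCW (hB3 E hΔ hE)).isModularGaloisRepTate 3

/-! ## Calibration: the exact `(ℚ, 3)` slice of FLS Thm 3 that closer D consumes, and where it sits -/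

/-- The `(K, p) = (ℚ, 3)` instance of `FLS2015_theorem3` — the only slice closer D uses.  A typer who
prefers the smallest seat files THIS (it is implied by `FLS2015_theorem3`, below, and — outside the
tree — by BCDT Thm A; it is NOT implied in-tree by `CDT_theorem_7_2_1`, which needs `27 ∤ N`). -/
def FLSThreeRat : Prop :=
  ∀ (E : WeierstrassCurve (𝓞 ℚ)), E.Δ ≠ 0 →
    ModPImageAbsIrreducibleOverCyclotomic (E.baseChange ℚ) 3 → IsAutomorphicOfWeightZero E

/-- [folklore] -/
theorem flsThreeRat_of_FLS2015_theorem3 (h : FLS2015_theorem3) : FLSThreeRat :=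
  fun E hΔ himg => h ℚ E hΔ 3 (Or.inl rfl) himg

/-- Closer D from the slice alone (same proof as `stub_liftThree_of_FLS2015_theorem3`). -/
theorem stub_liftThree_of_flsThreeRat (h : FLSThreeRat) (hB3 : IsModularOfAutomorphicRat) :
    SigStubLiftThree := by
  intro W _ ρ hρ hirr _ _
  haveI : NeZero (W.conductorNorm ℤ) := ⟨(WeierstrassCurve.conductorNorm_pos_holds W).ne'⟩
  obtain ⟨E, C, _, hΔ, hCW⟩ := exists_integralModel W
  haveI : NeZero ((E.baseChange ℚ).conductorNorm ℤ) :=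
    ⟨(WeierstrassCurve.conductorNorm_pos_holds (E.baseChange ℚ)).ne'⟩
  have himgW : ModPImageAbsIrreducibleOverCyclotomic W 3 :=
    modPImageAbsIrreducibleOverCyclotomic_three_of_isAbsIrreducibleOverSqrt W ρ hρ hirr
  have himgE : ModPImageAbsIrreducibleOverCyclotomic (E.baseChange ℚ) 3 := by
    intro ρ' hρ' L _ _ _
    have hW : W.IsTorsionGaloisRep 3 ρ' := by
      have h' := MatarNekovar2019.isTorsionGaloisRep_smul (E.baseChange ℚ) C⁻¹ hρ'
      rwa [← hCW, inv_smul_smul] at h'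
    exact himgW ρ' hW L
  exact (isModular_of_smul_eq W C (E.baseChange ℚ) hCW (hB3 E hΔ (h E hΔ himgE))).isModularGaloisRepTate 3

end Summit.ABC.ABC.Cruxes.FreyModularity.Sketch.StubIdeas1g3

end
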